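import Summits.AnomalousDissipation.AnomalousDissipation.Theorems.SawtoothPulseCascadeK1LocalisedCascadeLedgerThinTarget
import Summits.AnomalousDissipation.AnomalousDissipation.Theorems.SawtoothPulseCascadeK1LocalisedCascadeIterateComparison
import Summits.AnomalousDissipation.AnomalousDissipation.Theorems.SawtoothPulseCascadeK1LocalisedCascadeTrackedEnergyTransfer
import Summits.AnomalousDissipation.AnomalousDissipation.Theorems.SawtoothPulseCascadeK1LocalisedCascadeDatumSpectrum

/-!
# Sketch — crux idea `kink-set-sieve` (ad-ideate-p4 g3, lens `control`)

for `stmt-AnomalousDissipation-19491` = `…Theses.SawtoothPulseCascade.K1LocalisedCascade`, shape P of record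
(`∃ δ₀ ∈ Ioc 0 ¼, ∃ γ ∈ Icc 5 8, … K1Localised ⟨γ,δ₀,2,1,2⟩ (γ²−3)`).

THE LINE.  Couple the rounded cascade to the EXACT (piecewise-affine) sawtooth cascade ONCE, uniformly in `n`
(`UniformCoupling`; the lane's `K1Start.sqrt_integral_iterate_sub_exact_le` with a phase-dependent Gaussian cut `M_j`),
and decide the S-D target on the exact iterates `a⁰_n = datum ∘ Φ_n`, `Φ_n ∈ PL(SL₂(ℤ))`:
`a⁰_n = Σ_ι 1_{Π_ι}·sin(2π(k_ι·x + c_ι))` with polygonal pieces `Π_ι` and integer carriers `k_ι = A_ιᵀe₀` ALL in the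
unstable cone and ALL of size `≥ (γ²−23/10)ⁿ` (`sawtooth_cone_step` on every itinerary) — above the threshold
`(1+1/250)c(γ²−3)ⁿ` for every `c < 1`.  Hence every sub-threshold Fourier coefficient of `a⁰_n` is KINK DIFFRACTION:
on each horizontal line the transform is a sum over the cuts `x_c` of boundary terms `β_c e(−ξx_c)`, `|β_c| ≤ (1/f_L+1/f_R)/2π`
(`f` = local horizontal frequency `≥ (γ²−2.3)ⁿ`), and the DUAL WEIGHTED LARGE SIEVE (`WeightedDualLargeSieve`, Montgomery–Vaughan)
bounds the low band by `(1−s)⁻² Σ_c (2X+1+3/(2δ_c))|β_c|²`, `s = X/f_min ≤ 1.004c/gⁿ`.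
CONTROLLING QUANTITIES (material invariants of the kink set, not an energy): `κ_n = Σ_cuts (length)/(carrier)` = cuts per
wavelength per line, and the gap profile `m_c = δ_c·f` in wavelengths.  By the `SL₂` identity `adj(A)·J = J·Aᵀ`
(`adjugate_mul_rot`, PROVED) a cut parallel to its wavefront is stretched by the backward map exactly as its carrier grows, so
`κ` and `m` are invariant once aligned; births are `O(N_j/λ^{j+1})`, summable.  Numerics (kit j302405): `κ_n = 0.286, 0.294`
(γ=8, n=1,2), `0.54` (γ=5, n=3); sieve bound `6.9%·E` (γ=8,n=2,c=0.1), `21.6%·E` (γ=5,n=3,c=0.1) against a target of `< 100%·E`.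
Channel 2 (high off-cone) of the exact iterate → 0 like `N_n/f_n` (aligned edges radiate radially; only young edges and
vertices radiate across the cone) — `ExactOffConeDecay`.

PROVED here (kernel-checked): `adjugate_mul_rot` (the SL₂ identity behind the material invariance), and the ASSEMBLY
`k1Localised_of_kinkSieve`: `UniformCoupling C` + `ExactLowBandSieve c Q₁` + `ExactOffConeDecay c Q₂` +
`(√Q₁ + C√δ₀)² + (√Q₂ + C√δ₀)² < ½` ⇒ `K1Localised P (γ²−3)` on shape P (via `K1Start.tsum_weight_le_sq_sqrt_add` and
`K1Ledger.From.k1Localised_of_thin_lowBand_offCone`).  TYPED (conjectural inputs of the line): `UniformCoupling`,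
`ExactLowBandSieve`, `ExactOffConeDecay`; TYPED literature input: `WeightedDualLargeSieve` [Montgomery–Vaughan 1973, Thm 1;
in-tree neighbours: `ParityWave0LargeSieveProofs.largeSieve_dual` (uniform δ, proved), `montgomeryVaughan_hilbertInequality_holds`
(weighted Hilbert inequality, proved)].
-/

set_option linter.dupNamespace false

noncomputable section

namespace Summit.AnomalousDissipation.AnomalousDissipation.Cruxes.K1LocalisedCascade.KinkSieve

open MeasureTheory Set Filter Topology UnitAddTorus Function
open scoped Real
open Literature.Analysis Literature.Analysis.FunctionSpaces Literature.Analysis.FunctionSpaces.Torus Literature.Analysis.FluidPDE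
open Literature.Analysis.FluidPDE.ShearStage
open Literature.Analysis.FluidPDE.SawtoothCascade Literature.Analysis.FluidPDE.SawtoothCascade.CascadeParams
open Summit.AnomalousDissipation.AnomalousDissipation.Theorems.SawtoothPulseCascade.K1Ledger.From
open Summit.AnomalousDissipation.AnomalousDissipation.Theorems.SawtoothPulseCascade.K1Start

/-! ## §0 The `SL₂` identity behind the material invariance of "cuts per wavelength" (PROVED) -/

/-- `adj(A)·J = J·Aᵀ` for every real `2×2` matrix (`J` = rotation by `π/2`).  For `det A = 1` this reads `A⁻¹(Jv) = J(Aᵀv)`: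
the backward cascade map `A⁻¹` stretches a cut segment parallel to the wavefront `Jk` by exactly the factor `|Aᵀk|/|k|` by which
the frequency cocycle grows its carrier `k` — so (cut length)/(carrier) is a material invariant of aligned cuts. [folklore] -/
theorem adjugate_mul_rot (A : Matrix (Fin 2) (Fin 2) ℝ) :
    A.adjugate * !![(0 : ℝ), -1; 1, 0] = !![(0 : ℝ), -1; 1, 0] * A.transpose := by
  rw [Matrix.adjugate_fin_two]
  ext i j
  fin_cases i <;> fin_cases j <;> simp [Matrix.mul_apply, Fin.sum_univ_two]

/-- Vector form: `adj(A)(Jv) = J(Aᵀv)` componentwise, `J(v₀,v₁) = (−v₁, v₀)`. [folklore] -/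
theorem adj_apply_rot (a b c d v₀ v₁ : ℝ) :
    (d * (-v₁) + (-b) * v₀ = -(b * v₀ + d * v₁)) ∧ ((-c) * (-v₁) + a * v₀ = a * v₀ + c * v₁) := by
  constructor <;> ring

/-! ## §1 The two channels of the S-D target and the two cascades -/

/-- LOW BAND of phase `n` at threshold constant `c`: `Σ'[|k₀| < (1+1/250)c(γ²−3)ⁿ] ‖𝓕f(k)‖²`. -/
def lowBand (P : CascadeParams) (c : ℝ) (n : ℕ) (f : UnitAddTorus (Fin 2) → ℝ) : ℝ :=
  ∑' k : Fin 2 → ℤ, (if |((k 0 : ℤ) : ℝ)| < (1 + 1 / 250) * (c * (P.γ ^ 2 - 3) ^ n) then (1 : ℝ) else 0) *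
    ‖mFourierCoeff (fun x => (f x : ℂ)) k‖ ^ 2

/-- HIGH OFF-CONE channel of phase `n`: `Σ'[(1+1/250)c(γ²−3)ⁿ ≤ |k₀| ∧ 13/10·|k₀| < γ|k₁|] ‖𝓕f(k)‖²`. -/
def highOffCone (P : CascadeParams) (c : ℝ) (n : ℕ) (f : UnitAddTorus (Fin 2) → ℝ) : ℝ :=
  ∑' k : Fin 2 → ℤ, (if (1 + 1 / 250) * (c * (P.γ ^ 2 - 3) ^ n) ≤ |((k 0 : ℤ) : ℝ)| ∧
      13 / 10 * |((k 0 : ℤ) : ℝ)| < P.γ * |((k 1 : ℤ) : ℝ)| then (1 : ℝ) else 0) *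
    ‖mFourierCoeff (fun x => (f x : ℂ)) k‖ ^ 2

/-- The EXACT-sawtooth recursion (lane convention of `…IterateComparison`, hypotheses form, no new object):
`a⁰₀ = datum`, `b⁰_j(x) = a⁰_j(x − γ·tri(2πN_j x₁)/(2πN_j)·e₀)`, `a⁰_{j+1}(x) = b⁰_j(x − γ·tri(2πN_j x₀)/(2πN_j)·e₁)`. -/
def IsExactCascade (P : CascadeParams) (a0 b0 : ℕ → UnitAddTorus (Fin 2) → ℝ) : Prop :=
  a0 0 = datum ∧
    (∀ j, b0 j = fun x => a0 j (x - Pi.single 0 ((((periodic_exactProfile P j).lift (x 1) : ℝ) : UnitAddCircle)))) ∧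
    (∀ j, a0 (j + 1) = fun x => b0 j (x - Pi.single 1 ((((periodic_exactProfile P j).lift (x 0) : ℝ) : UnitAddCircle))))

/-! ## §2 The inputs of the line (TYPED; conjectural except the literature fact) -/

/-- **K7 · uniform coupling** (support-sized: the lane's `sqrt_integral_iterate_sub_exact_le` run with a phase-dependent cut
`M_j² ≈ 2((4j+1)log(1+γ) + log(1/δ_j))`, whose corner-layer terms `√(64M_jδ₀/(π·2ʲ))` are summable in `j`):
the rounded and the exact inviscid iterates stay `C√δ₀`-close in `L²`, UNIFORMLY IN `n`. -/
def UniformCoupling (P : CascadeParams) (C : ℝ) : Prop :=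
  ∀ (hδ₀ : 0 < P.δ₀) (hd : 0 < P.d) (a b : ℕ → UnitAddTorus (Fin 2) → ℝ),
    (∀ j, IsSmooth (a j)) → a 0 = datum →
    (∀ j, b j = a j ∘ shearMap 0 1 (amp ⟨P.U j, P.U_periodic j, P.contDiff_U (P.δ_pos hδ₀ hd j)⟩ P.γ)) →
    (∀ j, a (j + 1) = b j ∘ shearMap 1 0 (amp ⟨P.U j, P.U_periodic j, P.contDiff_U (P.δ_pos hδ₀ hd j)⟩ P.γ)) →
    ∀ (a0 b0 : ℕ → UnitAddTorus (Fin 2) → ℝ), IsExactCascade P a0 b0 →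
    ∀ n, Real.sqrt (∫ x : UnitAddTorus (Fin 2), ‖((a n x : ℝ) : ℂ) - ((a0 n x : ℝ) : ℂ)‖ ^ 2) ≤ C * Real.sqrt P.δ₀

/-- **K1–K4 · exact low-band sieve** (THE CRUX OF THE LINE): for the exact PL iterate the low band at threshold constant `c` is
eventually `≤ Q₁` — to be proved line-by-line from the kink-set boundary-term expansion, the dual weighted large sieve and the
material bound on cuts-per-wavelength / gaps-in-wavelengths.  Numerics: `≈ 0.07·E … 0.22·E` at `c = 1/10` (j302405). -/
def ExactLowBandSieve (P : CascadeParams) (c Q₁ : ℝ) : Prop :=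
  ∀ (a0 b0 : ℕ → UnitAddTorus (Fin 2) → ℝ), IsExactCascade P a0 b0 → ∃ n₁ : ℕ, ∀ n, n₁ ≤ n → lowBand P c n (a0 n) ≤ Q₁

/-- **K6 · exact off-cone decay**: the high off-cone channel of the exact PL iterate is eventually `≤ Q₂` (heuristically `→ 0`
like `N_n/f_n = (2/(γ²−2.3))ⁿ`: aligned straight cuts radiate along the carrier direction only). -/
def ExactOffConeDecay (P : CascadeParams) (c Q₂ : ℝ) : Prop :=
  ∀ (a0 b0 : ℕ → UnitAddTorus (Fin 2) → ℝ), IsExactCascade P a0 b0 → ∃ n₂ : ℕ, ∀ n, n₂ ≤ n → highOffCone P c n (a0 n) ≤ Q₂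

/-- **Literature input · dual large sieve with variable spacing** (Montgomery–Vaughan 1973, Thm 1, dual/weighted form; Montgomery
1978 §4–§6): for points `x_r ∈ ℝ/ℤ` with `δ_r = min_{s≠r} ‖x_r − x_s‖ > 0` and any `b_r ∈ ℂ`,
`Σ_{M<n≤M+N} |Σ_r b_r e(n x_r)|² ≤ Σ_r (N + 3/2·δ_r⁻¹)|b_r|²`.  In-tree neighbours: `ParityWave0LargeSieveProofs.largeSieve_dual`
(uniform `δ`, proved), `montgomeryVaughan_hilbertInequality_holds` (weighted Hilbert inequality, proved). -/
def WeightedDualLargeSieve : Prop :=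
  ∀ (R : ℕ) (x : Fin R → ℝ) (b : Fin R → ℂ) (δ : Fin R → ℝ), (∀ r, 0 < δ r) →
    (∀ r s, r ≠ s → ∀ m : ℤ, δ r ≤ |x r - x s - m|) →
    ∀ (M : ℤ) (N : ℕ),
      ∑ n ∈ Finset.Ioc M (M + N), ‖∑ r, b r * Complex.exp (2 * π * Complex.I * (n * x r))‖ ^ 2 ≤
        ∑ r, ((N : ℝ) + 3 / 2 * (δ r)⁻¹) * ‖b r‖ ^ 2

/-! ## §3 The assembly (PROVED): coupling + exact sieve + exact off-cone decay decide `K1Localised` on shape P -/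

/-- **PROVED.**  On shape P (`N₀ = 1`, `ρN = 2`, `d = 2`, `5 ≤ γ ≤ 8`, `0 < δ₀ ≤ ¼`): a uniform coupling constant `C`, an exact
low-band bound `Q₁` and an exact off-cone bound `Q₂` at one threshold constant `c > 0` with
`(√Q₁ + C√δ₀)² + (√Q₂ + C√δ₀)² < ½ = ‖datum‖²` give `K1Localised P (γ² − 3)` — by `L²`-stability of the two channel energies
(`K1Start.tsum_weight_le_sq_sqrt_add`) and the by-name closer `K1Ledger.From.k1Localised_of_thin_lowBand_offCone`. -/
theorem k1Localised_of_kinkSieve (P : CascadeParams) (hγ : 5 ≤ P.γ) (hγ' : P.γ ≤ 8) (hδ₀ : 0 < P.δ₀)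
    (hδ₀' : P.δ₀ ≤ 1 / 4) (hd : P.d = 2) (hN₀ : P.N₀ = 1) (hρN : P.ρN = 2) {c C Q₁ Q₂ : ℝ} (hc : 0 < c)
    (hnum : (Real.sqrt Q₁ + C * Real.sqrt P.δ₀) ^ 2 + (Real.sqrt Q₂ + C * Real.sqrt P.δ₀) ^ 2 < 1 / 2)
    (hK : UniformCoupling P C) (h1 : ExactLowBandSieve P c Q₁) (h2 : ExactOffConeDecay P c Q₂) :
    K1Localised P (P.γ ^ 2 - 3) := by
  have hdpos : 0 < P.d := by rw [hd]; norm_num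
  -- the rounded inviscid iterates of the datum
  let φ : ℕ → ShearProfile := fun j => amp ⟨P.U j, P.U_periodic j, P.contDiff_U (P.δ_pos hδ₀ hdpos j)⟩ P.γ
  let a : ℕ → UnitAddTorus (Fin 2) → ℝ := fun n =>
    Nat.rec (motive := fun _ => UnitAddTorus (Fin 2) → ℝ) datum (fun j aj => (aj ∘ shearMap 0 1 (φ j)) ∘ shearMap 1 0 (φ j)) n
  let b : ℕ → UnitAddTorus (Fin 2) → ℝ := fun j => a j ∘ shearMap 0 1 (φ j)
  have h0 : a 0 = datum := rfl
  have hb : ∀ j, b j = a j ∘ shearMap 0 1 (φ j) := fun j => rfl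
  have hab : ∀ j, a (j + 1) = b j ∘ shearMap 1 0 (φ j) := fun j => rfl
  have hdat : IsSmooth datum := by
    have hper : Function.Periodic (fun s : ℝ => Real.sin (2 * Real.pi * s)) 1 := fun s => by
      simp [mul_add, Real.sin_add_two_pi]
    have hl : Torus.lift datum = fun y : EuclideanSpace ℝ (Fin 2) => Real.sin (2 * Real.pi * y 0) := by
      funext y
      exact Torus.lift_coordFun_apply hper 0 y
    unfold Torus.IsSmooth
    rw [hl]
    exact Real.contDiff_sin.comp (contDiff_const.mul (contDiff_euclidean.1 contDiff_id 0))
  have has : ∀ j, IsSmooth (a j) := by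
    intro j
    induction j with
    | zero => exact hdat
    | succ j ih => exact (ih.comp_shearMap 0 1 (φ j)).comp_shearMap 1 0 (φ j)
  -- the exact inviscid iterates of the datum
  let σH : ℕ → UnitAddTorus (Fin 2) → UnitAddTorus (Fin 2) := fun j x =>
    x - Pi.single 0 ((((periodic_exactProfile P j).lift (x 1) : ℝ) : UnitAddCircle))
  let σV : ℕ → UnitAddTorus (Fin 2) → UnitAddTorus (Fin 2) := fun j x =>
    x - Pi.single 1 ((((periodic_exactProfile P j).lift (x 0) : ℝ) : UnitAddCircle))
  let a0 : ℕ → UnitAddTorus (Fin 2) → ℝ := fun n =>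
    Nat.rec (motive := fun _ => UnitAddTorus (Fin 2) → ℝ) datum (fun j aj => (aj ∘ σH j) ∘ σV j) n
  let b0 : ℕ → UnitAddTorus (Fin 2) → ℝ := fun j => a0 j ∘ σH j
  have h00 : a0 0 = datum := rfl
  have hb0 : ∀ j, b0 j = fun x => a0 j (x - Pi.single 0 ((((periodic_exactProfile P j).lift (x 1) : ℝ) : UnitAddCircle))) :=
    fun j => rfl
  have hab0 : ∀ j, a0 (j + 1) = fun x => b0 j (x - Pi.single 1 ((((periodic_exactProfile P j).lift (x 0) : ℝ) : UnitAddCircle))) :=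
    fun j => rfl
  have hex : IsExactCascade P a0 b0 := ⟨h00, hb0, hab0⟩
  -- continuity (for the `L²`-stability lemma)
  have hca : ∀ n, Continuous fun x => ((a n x : ℝ) : ℂ) := fun n => Complex.continuous_ofReal.comp (has n).continuous
  have hca0 : ∀ n, Continuous fun x => ((a0 n x : ℝ) : ℂ) := fun n =>
    Complex.continuous_ofReal.comp (continuous_exactIterate P a has h0 a0 b0 h00 hb0 hab0 n).1
  -- the three inputs
  have hdist := hK hδ₀ hdpos a b has h0 hb hab a0 b0 hex
  obtain ⟨n₁, hn₁⟩ := h1 a0 b0 hex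
  obtain ⟨n₂, hn₂⟩ := h2 a0 b0 hex
  -- indicator weights are in `[0,1]`
  have hI0 : ∀ (p : Prop) [Decidable p], (0 : ℝ) ≤ (if p then (1 : ℝ) else 0) := fun p _ => by split_ifs <;> norm_num
  have hI1 : ∀ (p : Prop) [Decidable p], (if p then (1 : ℝ) else 0) ≤ 1 := fun p _ => by split_ifs <;> norm_num
  -- channel-wise transfer exact → rounded
  have hlow : ∀ n, n₁ ≤ n → lowBand P c n (a n) ≤ (Real.sqrt Q₁ + C * Real.sqrt P.δ₀) ^ 2 := by
    intro n hn
    exact tsum_weight_le_sq_sqrt_add (hca n) (hca0 n) (fun k => hI0 _) (fun k => hI1 _) (hn₁ n hn) (hdist n)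
  have hoff : ∀ n, n₂ ≤ n → highOffCone P c n (a n) ≤ (Real.sqrt Q₂ + C * Real.sqrt P.δ₀) ^ 2 := by
    intro n hn
    exact tsum_weight_le_sq_sqrt_add (hca n) (hca0 n) (fun k => hI0 _) (fun k => hI1 _) (hn₂ n hn) (hdist n)
  -- the by-name closer
  have hQ : (Real.sqrt Q₁ + C * Real.sqrt P.δ₀) ^ 2 + (Real.sqrt Q₂ + C * Real.sqrt P.δ₀) ^ 2 < Torus.scalarL2Sq datum := by
    rw [scalarL2Sq_datum]; exact hnum
  refine k1Localised_of_thin_lowBand_offCone P hγ hγ' hδ₀ hδ₀' hd hN₀ hρN (Lm := 1000) le_rfl a b has h0 hb hab hc hQ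
    (i₁ := max n₁ n₂) fun n hn => ?_
  have h₁ := hlow n ((le_max_left _ _).trans hn)
  have h₂ := hoff n ((le_max_right _ _).trans hn)
  exact add_le_add h₁ h₂

/-- **PROVED, packaged**: the whole line in one implication — for SOME shape-P instance with `δ₀` small enough that
`(√Q₁ + C√δ₀)² + (√Q₂ + C√δ₀)² < ½`, the three inputs decide the crux conjunct `K1Localised`. -/
theorem k1Localised_of_kinkSieve_small_δ₀ (P : CascadeParams) (hγ : 5 ≤ P.γ) (hγ' : P.γ ≤ 8) (hδ₀ : 0 < P.δ₀)
    (hδ₀' : P.δ₀ ≤ 1 / 4) (hd : P.d = 2) (hN₀ : P.N₀ = 1) (hρN : P.ρN = 2) {c C Q₁ Q₂ : ℝ} (hc : 0 < c)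
    (hC : 0 ≤ C) (hQ₁ : 0 ≤ Q₁) (hQ₂ : 0 ≤ Q₂) (hsum : Q₁ + Q₂ < 1 / 2)
    (hsmall : Real.sqrt P.δ₀ ≤ (1 / 2 - (Q₁ + Q₂)) / (8 * (C + 1) * (Real.sqrt Q₁ + Real.sqrt Q₂ + C + 1)))
    (hK : UniformCoupling P C) (h1 : ExactLowBandSieve P c Q₁) (h2 : ExactOffConeDecay P c Q₂) :
    K1Localised P (P.γ ^ 2 - 3) := by
  refine k1Localised_of_kinkSieve P hγ hγ' hδ₀ hδ₀' hd hN₀ hρN hc ?_ hK h1 h2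
  set s := Real.sqrt P.δ₀ with hs
  have hs0 : 0 ≤ s := Real.sqrt_nonneg _
  have hs1 : s ≤ 1 / 2 := by
    rw [hs, show (1 / 2 : ℝ) = Real.sqrt (1 / 4) by
      rw [show (1 / 4 : ℝ) = (1 / 2) ^ 2 by norm_num, Real.sqrt_sq (by norm_num : (0 : ℝ) ≤ 1 / 2)]]
    exact Real.sqrt_le_sqrt hδ₀'
  have hq1 : 0 ≤ Real.sqrt Q₁ := Real.sqrt_nonneg _
  have hq2 : 0 ≤ Real.sqrt Q₂ := Real.sqrt_nonneg _
  have e1 : (Real.sqrt Q₁) ^ 2 = Q₁ := Real.sq_sqrt hQ₁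
  have e2 : (Real.sqrt Q₂) ^ 2 = Q₂ := Real.sq_sqrt hQ₂
  have hden : 0 < 8 * (C + 1) * (Real.sqrt Q₁ + Real.sqrt Q₂ + C + 1) := by positivity
  have hkey : s * (8 * (C + 1) * (Real.sqrt Q₁ + Real.sqrt Q₂ + C + 1)) ≤ 1 / 2 - (Q₁ + Q₂) :=
    (le_div_iff₀ hden).1 hsmall
  -- expand and bound the cross and square terms by `s · den`
  have hexp : (Real.sqrt Q₁ + C * s) ^ 2 + (Real.sqrt Q₂ + C * s) ^ 2 =
      Q₁ + Q₂ + s * (2 * C * (Real.sqrt Q₁ + Real.sqrt Q₂) + 2 * C ^ 2 * s) := by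
    rw [add_sq, add_sq, e1, e2]; ring
  rw [hexp]
  have hb : 2 * C * (Real.sqrt Q₁ + Real.sqrt Q₂) + 2 * C ^ 2 * s < 8 * (C + 1) * (Real.sqrt Q₁ + Real.sqrt Q₂ + C + 1) := by
    nlinarith [mul_nonneg hC hq1, mul_nonneg hC hq2, mul_nonneg (mul_nonneg hC hC) hs0, sq_nonneg C]
  by_cases hs00 : s = 0
  · rw [hs00]; linarith
  · have hspos : 0 < s := lt_of_le_of_ne hs0 (Ne.symm hs00)
    have := mul_lt_mul_of_pos_left hb hspos
    linarith

end Summit.AnomalousDissipation.AnomalousDissipation.Cruxes.K1LocalisedCascade.KinkSieve
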